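import Summits.QuantumFields.YangMills.Theorems.BalabanUVNodesN15TwoSpacingGluingCurvedKnitSmallFieldNodeFourCovariant
import Summits.QuantumFields.YangMills.Theorems.BalabanUVNodesN15SizedKnitSocket
import HarnessLib

/-!
# N15 (NE2) — PROGRAMME Σ, part Σ-E: ★★★ THE KNIT OF dag-n15-c's LIVE SMALL-FIELD FAMILY — `N15At` (the node's three conjuncts BY NAME) for `sfInstance`, whose OPERATOR layer reads a
# NON-ABELIAN matrix potential `U = e^{ηA}` in ALL FOUR (3.42) entries (n15-c FILE 145 `ne2PlusOperator_sf₄_cov`), the site ∕ unit layers being the genuine `U ≡ 1` kernels (S-D socket)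

WHO ∕ WHEN.  Cell `pub-ymgap`, seat `pub-ymgap-dag-n15-a` (KNIT-BY-NAME seat of Track-A DAG node N15 = NE2, g28); `--supports stmt-QuantumFields-27366 --as helper` (K3⁸; count-neutral).
Two plumbing `def`s (the index map `sfTG`, the `NE2Objects₁₁` literal `sfObjects`) + theorems.  Over dag-n15-c FILE 145 `…TwoSpacingGluingCurvedKnitSmallFieldNodeFourCovariant` (★★★
`ne2PlusOperator_sf₄_cov`; through it FILE 131 `SfIdx`, `sfGeo`, `sfInstance`, `sfFamily`, `sfGaugeBg`, `sfInstance_reg335_iff`, `CvX`, `cvM`, `cvBlk`) and this lane's S-D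
`…SizedKnitSocket` (`geoS`, `siteOnS`, `covOnS`, ★★★ `n15At_opGeoS_of_ne2PlusOperator`, ★★ `live_opGeoS`), part 30 (`s_N15_of_admits`) BY NAME; nothing in the tree is modified, nothing
of n15-c's restated.  This is the «(S) three-conjunct face» n15-c's HANDOFF (g14) deferred to the node's knit seat.

WHY.  Director-ym №252 (pub-ymgap INBOX l.44959): the located burden riding N15's road-(a) booking — «non-abelian `G(U)` dressing of NE2 ← N15 U-blind pin» (FLAG №13 ARMED-RESERVED) —
has dag-n15-c's road (c) as its typed home-to-be; a road-(c) literal any consumer could key on needs the NODE's `N15At` at n15-c's family.  n15-c's `sfInstance d mm ι hL i` IS, by `rfl`,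
the S-D socket's shape `⟨opGeo (geoS d hL sfTG (L^m) i) (CvX × ι) (liftBlk cvBlk ι), gf, Bc, Bf, pair⟩` (`cvM d L m kk hL = TGIndex.Mn d hL ⟨m+1, kk, _, r⟩`, both `MP (paramsOf …)`),
so ONE application of `n15At_opGeoS_of_ne2PlusOperator` knits their operator layer with G1's site kernel and part 76's (2.156) unit kernel re-based on their carrier, and `live_opGeoS` gives
dag-n15-w2's guard (`(L^m, kk)` jointly cofinal; the zero potential is (3.35)-regular at every `α₀ > 0` when `c₃₅ ≥ 0`).

WHAT.  §1 def `sfTG` (`⟨i.m + 1, i.kk, i.one_le, i.r⟩`), `sfTG_Mn` ∕ `geoS_sfTG` ∕ ★ `sfInstance_eq_opGeoS` (all `rfl`).  §2 ★★★ **`n15At_sf_of_ne2PlusOperator (E) (hop : NE2PlusOperator c₃₅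
(sfInstance d mm ι hL) (fun i => sfFamily d mm ι a e hL i (E i))) : N15At ⟨SfIdx d L, c₃₅, p, sfInstance, sfFamily … E, siteOnS a_S sfTG …, covOnS α β sfTG …, ⊤, dist⟩`** (`d ≥ 1`, odd
`L ≥ 3`, `a_S > 0`; ANY entry assignment `E` with the operator layer by name), ★★ `live_sf` (ANY kernels; `c₃₅ ≥ 0`), ★★★ `live_and_n15At_sf_of_ne2PlusOperator`.  §3 ★★★ **`n15At_sf₄_cov`**
= §2 ∘ n15-c's ★★★ with ITS hypotheses VERBATIM (`hL7 : 7 ≤ L`, `ha`, `hc35`, `he`, `μ₁ μ₂`, `E`, `hE1 hE2 hE3` — the three pinning equations copied letter for letter) + `d ≥ 1`, `a_S, α, β, p`: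
`Live ∧ N15At` — the FIRST `N15At` in the tree whose operator layer reads a NON-ABELIAN background.  §4 def `sfObjects d mm ι a e hL E c₃₅ p a_S α β : NE2Objects₁₁` + `rfl` +
`n15At_sfObjects (hop)` ∕ `live_sfObjects` + keyed face `s_N15_of_admits_sf (hop)`.

HONEST FRAMING ∕ LIMITS.  By-name bookkeeping over LANDED rows; NO estimate of this lane's.  OPERATOR layer = dag-n15-c's declared MODEL family (their header, FILE 145: global small-field
gauge = (3.35) with `u ≡ 1`; covariant Laplacian (3.50) ⊗ colour + FLAT nonlocal part (1.69) — NOT Bałaban's `Δ_a(U)` (3.26); two forward covariant gradients fill entries 1–2, the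
right-composed `𝒢∇*_U` is not there; C² window with all mixed second differences; King-block-mean pairing; doubled-torus cover; `L ≥ 7`); SITE ∕ UNIT = the genuine `U ≡ 1` kernels
(U-BLIND on this carrier — this lane's background-live site∕unit dressing (Σ-A∕Σ-C) reads the abelianised coefficient pair, not a matrix potential; porting it to `sfGaugeBg` needs the
(1.66)∕(2.156) engine ⊗ colour — not in the tree, said).  NOT the v7 pin's family (`K3V5Defs.N15PinnedSized` names S-B's `fullGSizedObjects`); NO re-pin asked; the N15 claim of record
(I.44870, road (a)) is untouched by this file; NE2⁺ NOT PRINTED ∕ NOT proved for Bałaban's `G(U)`; K3⁸ OPEN; counts UNMOVED (typed 28∕28 · discharged 7∕28 = 7∕27 excl. NODE O); one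
finite 𝕋⁴ at fixed ε per index — NOT ℝ⁴ ∕ infinite volume ∕ OS ∕ mass gap ∕ Clay.  Two plumbing `def`s ⇒ review ∕ audit lane.  No `sorry`, `instance`, `notation`, `maxHeartbeats`;
standard axioms.
-/


noncomputable section

open scoped BigOperators Matrix Matrix.Norms.Frobenius

namespace Summit.QuantumFields.YangMills.BalabanUVNodes.N15.GenuineRecord

open Literature.MathematicalPhysics.QuantumFieldTheory.Balaban1983to89
open Literature.MathematicalPhysics.QuantumFieldTheory.Balaban1983to89.T4Continuum (T4Family ULoop)
open Literature.MathematicalPhysics.QuantumFieldTheory.Balaban1983to89.T4EtaRate (PairedInstance EtaPairing NE2PlusOperator NE2PlusSite NE2PlusUnit)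
open Literature.MathematicalPhysics.QuantumFieldTheory.Balaban1983to89.B5Prop11Plancherel (Tor fine)
open Node00 (NE2Objects₁₁)
open Summit.QuantumFields.YangMills.BalabanUVNodes.N15.OperatorReadout (opGeo)
open Summit.QuantumFields.YangMills.BalabanUVNodes.N15.TwoGrid (TGIndex)
open Summit.QuantumFields.YangMills.BalabanUVNodes.N15.VectorPiece (bshiftEquiv kingPrV unitTorusGeoS)
open Summit.QuantumFields.YangMills.BalabanUVNodes.N15.MatrixSpecies (liftMap liftBlk)
open Summit.QuantumFields.YangMills.BalabanUVNodes.N15.BackgroundLayer (v1GaugeBg gavgM fineGeo bgInstanceM₂R)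
open Literature.MathematicalPhysics.QuantumFieldTheory.Balaban1983to89.T4EtaRateDefect (idef)
open Literature.MathematicalPhysics.QuantumFieldTheory.Balaban1983to89.T4EtaRateCoeffDefect (pull)
open Literature.Barriers.QuantumFields (traceForm)
open Summit.QuantumFields.YangMills.BalabanUVNodes.N15.BackgroundLayer (covLapM)
open Summit.QuantumFields.YangMills.BalabanUVNodes.N15.MatrixSpecies (coordMat covD)
open Summit.QuantumFields.YangMills.BalabanUVNodes.N15.CurvedSpecies (gaugePair)
open Summit.QuantumFields.YangMills.BalabanUVNodes.N15.Gluing (SfIdx sfGeo sfInstance sfFamily sfGaugeBg sfPairing sfGeo_L_ne_zero CvX CvX' cvM cvBlk sfInstance_reg335_iff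
  cvGlued cvGlued' cvNL cvNL' ne2PlusOperator_sf₄_cov)
open Summit.QuantumFields.YangMills.BalabanUVNodes.N15.AtKeyedHome (s_N15_of_admits)
open Summit.QuantumFields.YangMills.BalabanUVNodes.N15.PairedFamilyGuard (Live)
open YMDAG.UVSplit (N15At ne2OfRecord₁₁)

variable (d : ℕ) {L : ℕ} [NeZero L] (mm ι : Type) [Fintype mm] [DecidableEq mm] [Fintype ι] [DecidableEq ι]

/-! ## §1 n15-c's instance family IS the S-D socket's shape -/

/-- THE TORUS INDEX OF A SMALL-FIELD INDEX: doubled torus `2L·L^m = 2L^{m+1}` (`m_T = m + 1`), `kk` coarse scales, `r` extra fine scales. [bookkeeping] -/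
def sfTG (i : SfIdx d L) : TGIndex := ⟨i.m + 1, i.kk, i.one_le, i.r⟩

omit [NeZero L] in
/-- `m_T = m + 1`. [folklore] -/
theorem sfTG_mT (i : SfIdx d L) : (sfTG d i).mT = i.m + 1 := rfl

omit [NeZero L] in
/-- n15-c's period vector IS the torus family's at the index: `cvM d L m kk hL = TGIndex.Mn d hL (sfTG i)` (both `MP (paramsOf d L (m+1) kk hL)`). [folklore] -/
theorem sfTG_Mn (hL : Odd L ∧ 1 < L) (i : SfIdx d L) : TGIndex.Mn d hL (sfTG d i) = cvM d L i.m i.kk hL := rfl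

omit [NeZero L] in
/-- n15-c's sized carrier IS the socket's `geoS` at `(sfTG, L^m)`. [folklore] -/
theorem geoS_sfTG (hL : Odd L ∧ 1 < L) (i : SfIdx d L) : geoS d hL (sfTG d) (fun i => (L : ℝ) ^ i.m) i = sfGeo d hL i := rfl

omit [DecidableEq mm] [DecidableEq ι] in
/-- ★ **n15-c's REALISED INSTANCE FAMILY IS THE S-D SOCKET's SHAPE** (`rfl`): coarse carrier `opGeo (geoS d hL sfTG (L^m) i) (CvX × ι) (liftBlk cvBlk ι)`, the other four fields its own. [bookkeeping] -/
theorem sfInstance_eq_opGeoS (hL : Odd L ∧ 1 < L) :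
    sfInstance d mm ι hL = fun i => (⟨opGeo (geoS d hL (sfTG d) (fun i => (L : ℝ) ^ i.m) i) (CvX d L i.m i.kk hL × ι) (liftBlk (cvBlk d L i.m i.kk hL) ι),
        (sfInstance d mm ι hL i).gf, (sfInstance d mm ι hL i).Bc, (sfInstance d mm ι hL i).Bf, (sfInstance d mm ι hL i).pair⟩ : PairedInstance) := rfl

variable (a : ℝ) (e : Matrix mm mm ℂ ≃L[ℝ] (ι → ℝ))

/-! ## §2 The knit from an operator layer BY NAME; the guard -/

/-- ★★★ **THE KNIT OF n15-c's LIVE SMALL-FIELD FAMILY FROM ITS OPERATOR LAYER BY NAME.**  For `d ≥ 1`, odd `L ≥ 3`, `a_S > 0`, directions `α β`, any `p`, ANY entry assignment `E`: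
`NE2PlusOperator c₃₅ (sfInstance d mm ι hL) (sfFamily … E) → N15At ⟨SfIdx d L, c₃₅, p, sfInstance, sfFamily … E, siteOnS a_S sfTG …, covOnS α β sfTG …, ⊤, dist⟩` — ONE application of S-D
`n15At_opGeoS_of_ne2PlusOperator` (`m_T = m + 1 ≥ 1`); SITE = G1's `(Q′G′²Q′*)⁻¹`, UNIT = part 76's (2.156) `C^{(k)}`, both re-based on n15-c's carrier (U-blind, said). [bookkeeping] -/
theorem n15At_sf_of_ne2PlusOperator (hd : 1 ≤ d) (hLodd : Odd L) (hL2 : 2 ≤ L) (hL : Odd L ∧ 1 < L) {aS : ℝ} (haS : 0 < aS) (α β : Fin (d + 1))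
    {c35 : ℝ} (p : ℝ)
    (E : ∀ i : SfIdx d L, Fin 4 → (Fin (d + 1) → CvX' d L i.m i.kk i.r hL → Matrix mm mm ℂ) → ((CvX d L i.m i.kk hL × ι → ℝ) →ₗ[ℝ] (CvX' d L i.m i.kk i.r hL × ι → ℝ)))
    (hop : NE2PlusOperator c35 (sfInstance d mm ι hL) (fun i => sfFamily d mm ι a e hL i (E i))) :
    N15At { I := SfIdx d L, c35 := c35, p := p, pi := sfInstance d mm ι hL, Kop := fun i => sfFamily d mm ι a e hL i (E i),
            Ksite := siteOnS d hL aS (sfTG d) (fun i => (L : ℝ) ^ i.m) (fun i => CvX d L i.m i.kk hL × ι) (fun i => liftBlk (cvBlk d L i.m i.kk hL) ι) (fun i => (sfInstance d mm ι hL i).Bf),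
            Kunit := covOnS d hL α β (sfTG d) (fun i => (L : ℝ) ^ i.m) (fun i => CvX d L i.m i.kk hL × ι) (fun i => liftBlk (cvBlk d L i.m i.kk hL) ι) (fun i => (sfInstance d mm ι hL i).Bf),
            inΛ := fun _ _ => True, unitDist := fun i => (sfInstance d mm ι hL i).gc.dist } :=
  n15At_opGeoS_of_ne2PlusOperator (d := d) hL (sfTG d) (fun i => (L : ℝ) ^ i.m) (fun i => CvX d L i.m i.kk hL × ι) (fun i => liftBlk (cvBlk d L i.m i.kk hL) ι)
    (fun i => (sfInstance d mm ι hL i).gf) (fun i => (sfInstance d mm ι hL i).Bc) (fun i => (sfInstance d mm ι hL i).Bf) hd hLodd hL2 haS α β (fun _ => Nat.succ_pos _)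
    (fun i => (sfInstance d mm ι hL i).pair) p (fun i => sfFamily d mm ι a e hL i (E i)) hop

omit [DecidableEq ι] in
/-- ★★ **n15-c's FAMILY PASSES THE K3⁷∕K3⁸ GUARD, FOR ANY KERNELS** (dag-n15-w2's `Live` via S-D `live_opGeoS`): `(L^m, kk)` jointly cofinal (`SfIdx` ranges over all `m`, `kk ≥ 1`), and the
ZERO potential is (3.35)-∕(3.36)-regular at every `α₀ > 0` (skew-Hermitian, all window letters `0 ≤ c₃₅L^mα₀·…`; `c₃₅ ≥ 0`). [bookkeeping] -/
theorem live_sf (hL : Odd L ∧ 1 < L) {c35 : ℝ} (hc35 : 0 ≤ c35) (p : ℝ)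
    (Kop : ∀ i, B9.KernelFamily (sfInstance d mm ι hL i).gc (sfInstance d mm ι hL i).Bf) (Ksite Kunit : ∀ i, B9.SiteKernel (sfInstance d mm ι hL i).gc (sfInstance d mm ι hL i).Bf) :
    Live ⟨SfIdx d L, c35, p, sfInstance d mm ι hL, Kop, Ksite, Kunit, fun _ _ => True, fun i => (sfInstance d mm ι hL i).gc.dist⟩ := by
  refine live_opGeoS (d := d) hL (sfTG d) (fun i => (L : ℝ) ^ i.m) (fun i => CvX d L i.m i.kk hL × ι) (fun i => liftBlk (cvBlk d L i.m i.kk hL) ι)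
    (fun i => (sfInstance d mm ι hL i).gf) (fun i => (sfInstance d mm ι hL i).Bc) (fun i => (sfInstance d mm ι hL i).Bf) (fun i => (sfInstance d mm ι hL i).pair) c35 p Kop Ksite Kunit
    (fun M₅ k₀ => ?_) (fun i α₀ hα₀ => ?_)
  · obtain ⟨m, hm⟩ := pow_unbounded_of_one_lt M₅ (by exact_mod_cast hL.2 : (1 : ℝ) < (L : ℝ))
    exact ⟨⟨m, max k₀ 1, 0, le_max_right _ _⟩, hm.le, le_max_left _ _⟩
  · have h0 : (0 : ℝ) ≤ c35 * (L : ℝ) ^ i.m * α₀ := by positivity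
    have h1 : (sfInstance d mm ι hL i).Bf.one = (0 : Fin (d + 1) → CvX' d L i.m i.kk i.r hL → Matrix mm mm ℂ) := rfl
    have hreg : (sfInstance d mm ι hL i).Bf.Reg335 c35 α₀ (sfInstance d mm ι hL i).Bf.one := by
      rw [h1]
      refine (sfInstance_reg335_iff d mm ι hL i c35 α₀ _).2 ⟨fun μ x' => ?_, fun μ x' => ?_, fun μ κ x' => ?_, fun μ κ x' => ?_⟩
      · simp only [Pi.zero_apply, Matrix.conjTranspose_zero, neg_zero]
      · simp only [Pi.zero_apply, norm_zero]; exact h0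
      · simp only [Pi.zero_apply, sub_self, norm_zero]; positivity
      · simp only [Pi.zero_apply, sub_self, norm_zero]; positivity
    exact ⟨hreg, hreg⟩

/-- ★★★ **GUARD ∧ `N15At` FOR n15-c's FAMILY FROM ITS OPERATOR LAYER BY NAME** (`d ≥ 1`, odd `L ≥ 3`, `a_S > 0`, `c₃₅ ≥ 0`). [bookkeeping] -/
theorem live_and_n15At_sf_of_ne2PlusOperator (hd : 1 ≤ d) (hLodd : Odd L) (hL2 : 2 ≤ L) (hL : Odd L ∧ 1 < L) {aS : ℝ} (haS : 0 < aS) (α β : Fin (d + 1))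
    {c35 : ℝ} (hc35 : 0 ≤ c35) (p : ℝ)
    (E : ∀ i : SfIdx d L, Fin 4 → (Fin (d + 1) → CvX' d L i.m i.kk i.r hL → Matrix mm mm ℂ) → ((CvX d L i.m i.kk hL × ι → ℝ) →ₗ[ℝ] (CvX' d L i.m i.kk i.r hL × ι → ℝ)))
    (hop : NE2PlusOperator c35 (sfInstance d mm ι hL) (fun i => sfFamily d mm ι a e hL i (E i))) :
    Live ⟨SfIdx d L, c35, p, sfInstance d mm ι hL, fun i => sfFamily d mm ι a e hL i (E i),
        siteOnS d hL aS (sfTG d) (fun i => (L : ℝ) ^ i.m) (fun i => CvX d L i.m i.kk hL × ι) (fun i => liftBlk (cvBlk d L i.m i.kk hL) ι) (fun i => (sfInstance d mm ι hL i).Bf),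
        covOnS d hL α β (sfTG d) (fun i => (L : ℝ) ^ i.m) (fun i => CvX d L i.m i.kk hL × ι) (fun i => liftBlk (cvBlk d L i.m i.kk hL) ι) (fun i => (sfInstance d mm ι hL i).Bf),
        fun _ _ => True, fun i => (sfInstance d mm ι hL i).gc.dist⟩ ∧
      N15At { I := SfIdx d L, c35 := c35, p := p, pi := sfInstance d mm ι hL, Kop := fun i => sfFamily d mm ι a e hL i (E i),
              Ksite := siteOnS d hL aS (sfTG d) (fun i => (L : ℝ) ^ i.m) (fun i => CvX d L i.m i.kk hL × ι) (fun i => liftBlk (cvBlk d L i.m i.kk hL) ι) (fun i => (sfInstance d mm ι hL i).Bf),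
              Kunit := covOnS d hL α β (sfTG d) (fun i => (L : ℝ) ^ i.m) (fun i => CvX d L i.m i.kk hL × ι) (fun i => liftBlk (cvBlk d L i.m i.kk hL) ι) (fun i => (sfInstance d mm ι hL i).Bf),
              inΛ := fun _ _ => True, unitDist := fun i => (sfInstance d mm ι hL i).gc.dist } :=
  ⟨live_sf d mm ι hL hc35 p _ _ _, n15At_sf_of_ne2PlusOperator d mm ι a e hd hLodd hL2 hL haS α β p E hop⟩

/-! ## §3 ★★★ The knit fed with n15-c's FILE 145: the operator layer reads a NON-ABELIAN background in all four (3.42) entries -/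

/-- ★★★ **`Live ∧ N15At` FOR n15-c's LIVE SMALL-FIELD FAMILY, ALL FOUR OPERATOR ENTRIES CONSTRUCTED AND COVARIANT** — n15-c FILE 145 `ne2PlusOperator_sf₄_cov` (ITS hypotheses verbatim:
odd `L ≥ 7`, `a, c₃₅ > 0`, trace-form-orthonormal `e`, directions `μ₁ μ₂`, the entry assignment `E` pinned by the three equations `hE1 hE2 hE3`) fed to §2 (`d ≥ 1`, `a_S > 0`, `α β`, `p`):
the node's three conjuncts BY NAME at a family whose OPERATOR layer reads the matrix potential `A′` (`U = e^{η′A′}`, coarse partner the block mean) — entry 0 = the η-defect of the live glued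
propagators, entries 1–2 = covariant forward gradients `D^η_{R⁺_μ}𝒢`, entry 3 = the Laplacian defect —, SITE ∕ UNIT the genuine `U ≡ 1` kernels.  n15-c's MODEL caveats apply verbatim
(module docstring). [cite: Balaban1985BackgroundPropagators, Thm 3.1 (3.42) p.397, Thm 3.2 (3.48) p.398, Thm 3.15 (3.187) p.432 (quantifier templates); King1986, Lemma 4.5 (4.38) p.674 (A = 0 template)] -/
theorem n15At_sf₄_cov (hd : 1 ≤ d)
    (hL : Odd L ∧ 1 < L) (hL7 : 7 ≤ L) {a : ℝ} (ha : 0 < a) {c35 : ℝ} (hc35 : 0 < c35) (he : ∀ A B : Matrix mm mm ℂ, traceForm A B = e A ⬝ᵥ e B)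
    (μ₁ μ₂ : Fin (d + 1))
    (E : ∀ i : SfIdx d L, Fin 4 → (Fin (d + 1) → CvX' d L i.m i.kk i.r hL → Matrix mm mm ℂ) → ((CvX d L i.m i.kk hL × ι → ℝ) →ₗ[ℝ] (CvX' d L i.m i.kk i.r hL × ι → ℝ)))
    (hE1 : ∀ (i : SfIdx d L) (A' : Fin (d + 1) → CvX' d L i.m i.kk i.r hL → Matrix mm mm ℂ), E i 1 A' =
      idef (pull (liftMap (kingPrV L i.kk i.r (cvM d L i.m i.kk hL)) ι)) (pull (liftMap (kingPrV L i.kk i.r (cvM d L i.m i.kk hL)) ι))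
        (covD ((((L ^ i.r * L ^ i.kk : ℕ) : ℝ))⁻¹) (gaugePair (bshiftEquiv (cvM d L i.m i.kk hL) (L ^ i.r * L ^ i.kk)) (fun μ x' => coordMat e (ContinuousLinearMap.mulLeftRight ℝ (Matrix mm mm ℂ) (NormedSpace.exp (((((L ^ i.r * L ^ i.kk : ℕ) : ℝ))⁻¹) • A' μ x')) (NormedSpace.exp (((((L ^ i.r * L ^ i.kk : ℕ) : ℝ))⁻¹) • A' μ x'))ᴴ)) (Sum.inl μ₁)) (bshiftEquiv (cvM d L i.m i.kk hL) (L ^ i.r * L ^ i.kk) μ₁) ∘ₗ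
          cvGlued' d L i.m i.kk i.r hL a ((((L ^ i.r * L ^ i.kk : ℕ) : ℝ))⁻¹) ι e (fun _ _ => (1 : Matrix mm mm ℂ)) (fun μ x' => NormedSpace.exp (((((L ^ i.r * L ^ i.kk : ℕ) : ℝ))⁻¹) • A' μ x')) (cvNL' d L i.m i.kk i.r hL a ι) (fun _ => 0))
        (covD ((((L ^ i.kk : ℕ) : ℝ))⁻¹) (gaugePair (bshiftEquiv (cvM d L i.m i.kk hL) (L ^ i.kk)) (fun μ x => coordMat e (ContinuousLinearMap.mulLeftRight ℝ (Matrix mm mm ℂ) (NormedSpace.exp (((((L ^ i.kk : ℕ) : ℝ))⁻¹) • gavgM (Matrix mm mm ℂ) (Fin (d + 1)) (kingPrV L i.kk i.r (cvM d L i.m i.kk hL)) A' μ x)) (NormedSpace.exp (((((L ^ i.kk : ℕ) : ℝ))⁻¹) • gavgM (Matrix mm mm ℂ) (Fin (d + 1)) (kingPrV L i.kk i.r (cvM d L i.m i.kk hL)) A' μ x))ᴴ)) (Sum.inl μ₁)) (bshiftEquiv (cvM d L i.m i.kk hL) (L ^ i.kk) μ₁) ∘ₗ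
          cvGlued d L i.m i.kk hL a ((((L ^ i.kk : ℕ) : ℝ))⁻¹) ι e (fun _ _ => (1 : Matrix mm mm ℂ)) (fun μ x => NormedSpace.exp (((((L ^ i.kk : ℕ) : ℝ))⁻¹) • gavgM (Matrix mm mm ℂ) (Fin (d + 1)) (kingPrV L i.kk i.r (cvM d L i.m i.kk hL)) A' μ x)) (cvNL d L i.m i.kk hL a ι) (fun _ => 0)))
    (hE2 : ∀ (i : SfIdx d L) (A' : Fin (d + 1) → CvX' d L i.m i.kk i.r hL → Matrix mm mm ℂ), E i 2 A' =
      idef (pull (liftMap (kingPrV L i.kk i.r (cvM d L i.m i.kk hL)) ι)) (pull (liftMap (kingPrV L i.kk i.r (cvM d L i.m i.kk hL)) ι))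
        (covD ((((L ^ i.r * L ^ i.kk : ℕ) : ℝ))⁻¹) (gaugePair (bshiftEquiv (cvM d L i.m i.kk hL) (L ^ i.r * L ^ i.kk)) (fun μ x' => coordMat e (ContinuousLinearMap.mulLeftRight ℝ (Matrix mm mm ℂ) (NormedSpace.exp (((((L ^ i.r * L ^ i.kk : ℕ) : ℝ))⁻¹) • A' μ x')) (NormedSpace.exp (((((L ^ i.r * L ^ i.kk : ℕ) : ℝ))⁻¹) • A' μ x'))ᴴ)) (Sum.inl μ₂)) (bshiftEquiv (cvM d L i.m i.kk hL) (L ^ i.r * L ^ i.kk) μ₂) ∘ₗ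
          cvGlued' d L i.m i.kk i.r hL a ((((L ^ i.r * L ^ i.kk : ℕ) : ℝ))⁻¹) ι e (fun _ _ => (1 : Matrix mm mm ℂ)) (fun μ x' => NormedSpace.exp (((((L ^ i.r * L ^ i.kk : ℕ) : ℝ))⁻¹) • A' μ x')) (cvNL' d L i.m i.kk i.r hL a ι) (fun _ => 0))
        (covD ((((L ^ i.kk : ℕ) : ℝ))⁻¹) (gaugePair (bshiftEquiv (cvM d L i.m i.kk hL) (L ^ i.kk)) (fun μ x => coordMat e (ContinuousLinearMap.mulLeftRight ℝ (Matrix mm mm ℂ) (NormedSpace.exp (((((L ^ i.kk : ℕ) : ℝ))⁻¹) • gavgM (Matrix mm mm ℂ) (Fin (d + 1)) (kingPrV L i.kk i.r (cvM d L i.m i.kk hL)) A' μ x)) (NormedSpace.exp (((((L ^ i.kk : ℕ) : ℝ))⁻¹) • gavgM (Matrix mm mm ℂ) (Fin (d + 1)) (kingPrV L i.kk i.r (cvM d L i.m i.kk hL)) A' μ x))ᴴ)) (Sum.inl μ₂)) (bshiftEquiv (cvM d L i.m i.kk hL) (L ^ i.kk) μ₂) ∘ₗ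
          cvGlued d L i.m i.kk hL a ((((L ^ i.kk : ℕ) : ℝ))⁻¹) ι e (fun _ _ => (1 : Matrix mm mm ℂ)) (fun μ x => NormedSpace.exp (((((L ^ i.kk : ℕ) : ℝ))⁻¹) • gavgM (Matrix mm mm ℂ) (Fin (d + 1)) (kingPrV L i.kk i.r (cvM d L i.m i.kk hL)) A' μ x)) (cvNL d L i.m i.kk hL a ι) (fun _ => 0)))
    (hE3 : ∀ (i : SfIdx d L) (A' : Fin (d + 1) → CvX' d L i.m i.kk i.r hL → Matrix mm mm ℂ), E i 3 A' =
      idef (pull (liftMap (kingPrV L i.kk i.r (cvM d L i.m i.kk hL)) ι)) (pull (liftMap (kingPrV L i.kk i.r (cvM d L i.m i.kk hL)) ι)) ((covLapM (bshiftEquiv (cvM d L i.m i.kk hL) (L ^ i.r * L ^ i.kk)) ((((L ^ i.r * L ^ i.kk : ℕ) : ℝ))⁻¹) (gaugePair (bshiftEquiv (cvM d L i.m i.kk hL) (L ^ i.r * L ^ i.kk)) (fun μ x' => coordMat e (ContinuousLinearMap.mulLeftRight ℝ (Matrix mm mm ℂ) (NormedSpace.exp (((((L ^ i.r * L ^ i.kk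 : ℕ) : ℝ))⁻¹) • A' μ x')) (NormedSpace.exp (((((L ^ i.r * L ^ i.kk : ℕ) : ℝ))⁻¹) • A' μ x'))ᴴ)))) ∘ₗ (cvGlued' d L i.m i.kk i.r hL a ((((L ^ i.r * L ^ i.kk : ℕ) : ℝ))⁻¹) ι e (fun _ _ => (1 : Matrix mm mm ℂ)) (fun μ x' => NormedSpace.exp (((((L ^ i.r * L ^ i.kk : ℕ) : ℝ))⁻¹) • A' μ x')) (cvNL' d L i.m i.kk i.r hL a ι) (fun _ => 0))) ((covLapM (bshiftEquiv (cvM d L i.m i.kk hL) (L ^ i.kk)) ((((L ^ i.kk : ℕ) : ℝ))⁻¹) (gaugePair (bshiftEquiv (cvM d L i.m i.kk hL) (L ^ i.kk)) (fun μ x => coordMat e (ContinuousLinearMap.mulLeftRight ℝ (Matrix mm mm ℂ) (NormedSpace.exp (((((L ^ i.kk : ℕ) : ℝ))⁻¹) • gavgM (Matrix mm mm ℂ) (Fin (d + 1)) (kingPrV L i.kk i.r (cvM d L i.m i.kk hL)) A' μ x)) (NormedSpace.exp (((((L ^ i.kk : ℕ) : ℝ))⁻¹) • gavgM (Matrix mm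 mm ℂ) (Fin (d + 1)) (kingPrV L i.kk i.r (cvM d L i.m i.kk hL)) A' μ x))ᴴ)))) ∘ₗ (cvGlued d L i.m i.kk hL a ((((L ^ i.kk : ℕ) : ℝ))⁻¹) ι e (fun _ _ => (1 : Matrix mm mm ℂ)) (fun μ x => NormedSpace.exp (((((L ^ i.kk : ℕ) : ℝ))⁻¹) • gavgM (Matrix mm mm ℂ) (Fin (d + 1)) (kingPrV L i.kk i.r (cvM d L i.m i.kk hL)) A' μ x)) (cvNL d L i.m i.kk hL a ι) (fun _ => 0))))
    {aS : ℝ} (haS : 0 < aS) (α β : Fin (d + 1)) (p : ℝ) :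
    Live ⟨SfIdx d L, c35, p, sfInstance d mm ι hL, fun i => sfFamily d mm ι a e hL i (E i),
        siteOnS d hL aS (sfTG d) (fun i => (L : ℝ) ^ i.m) (fun i => CvX d L i.m i.kk hL × ι) (fun i => liftBlk (cvBlk d L i.m i.kk hL) ι) (fun i => (sfInstance d mm ι hL i).Bf),
        covOnS d hL α β (sfTG d) (fun i => (L : ℝ) ^ i.m) (fun i => CvX d L i.m i.kk hL × ι) (fun i => liftBlk (cvBlk d L i.m i.kk hL) ι) (fun i => (sfInstance d mm ι hL i).Bf),
        fun _ _ => True, fun i => (sfInstance d mm ι hL i).gc.dist⟩ ∧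
      N15At { I := SfIdx d L, c35 := c35, p := p, pi := sfInstance d mm ι hL, Kop := fun i => sfFamily d mm ι a e hL i (E i),
              Ksite := siteOnS d hL aS (sfTG d) (fun i => (L : ℝ) ^ i.m) (fun i => CvX d L i.m i.kk hL × ι) (fun i => liftBlk (cvBlk d L i.m i.kk hL) ι) (fun i => (sfInstance d mm ι hL i).Bf),
              Kunit := covOnS d hL α β (sfTG d) (fun i => (L : ℝ) ^ i.m) (fun i => CvX d L i.m i.kk hL × ι) (fun i => liftBlk (cvBlk d L i.m i.kk hL) ι) (fun i => (sfInstance d mm ι hL i).Bf),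
              inΛ := fun _ _ => True, unitDist := fun i => (sfInstance d mm ι hL i).gc.dist } :=
  live_and_n15At_sf_of_ne2PlusOperator d mm ι a e hd hL.1 (by omega) hL haS α β hc35.le p E
    (ne2PlusOperator_sf₄_cov d mm ι e hL hL7 ha hc35 he μ₁ μ₂ E hE1 hE2 hE3)

/-! ## §4 The `NE2Objects₁₁` literal of n15-c's family; keyed face -/

/-- **n15-c's LIVE SMALL-FIELD FAMILY AS RR-1's NE2 OBJECT LITERAL** (`NE2Objects₁₁`), field for field; the entry assignment `E` is a parameter (pinned by n15-c's three equations when fed). [bookkeeping] -/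
def sfObjects (hL : Odd L ∧ 1 < L)
    (E : ∀ i : SfIdx d L, Fin 4 → (Fin (d + 1) → CvX' d L i.m i.kk i.r hL → Matrix mm mm ℂ) → ((CvX d L i.m i.kk hL × ι → ℝ) →ₗ[ℝ] (CvX' d L i.m i.kk i.r hL × ι → ℝ)))
    (c35 p aS : ℝ) (α β : Fin (d + 1)) : NE2Objects₁₁ :=
  ⟨SfIdx d L, c35, p, sfInstance d mm ι hL, fun i => sfFamily d mm ι a e hL i (E i),
    siteOnS d hL aS (sfTG d) (fun i => (L : ℝ) ^ i.m) (fun i => CvX d L i.m i.kk hL × ι) (fun i => liftBlk (cvBlk d L i.m i.kk hL) ι) (fun i => (sfInstance d mm ι hL i).Bf),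
    covOnS d hL α β (sfTG d) (fun i => (L : ℝ) ^ i.m) (fun i => CvX d L i.m i.kk hL × ι) (fun i => liftBlk (cvBlk d L i.m i.kk hL) ι) (fun i => (sfInstance d mm ι hL i).Bf),
    fun _ _ => True, fun i => (sfInstance d mm ι hL i).gc.dist⟩

/-- the record map reads the literal as the rates bundle (`rfl`). [bookkeeping] -/
theorem ne2OfRecord₁₁_sfObjects (hL : Odd L ∧ 1 < L)
    (E : ∀ i : SfIdx d L, Fin 4 → (Fin (d + 1) → CvX' d L i.m i.kk i.r hL → Matrix mm mm ℂ) → ((CvX d L i.m i.kk hL × ι → ℝ) →ₗ[ℝ] (CvX' d L i.m i.kk i.r hL × ι → ℝ)))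
    (c35 p aS : ℝ) (α β : Fin (d + 1)) :
    ne2OfRecord₁₁ (sfObjects d mm ι a e hL E c35 p aS α β) =
      { I := SfIdx d L, c35 := c35, p := p, pi := sfInstance d mm ι hL, Kop := fun i => sfFamily d mm ι a e hL i (E i),
        Ksite := siteOnS d hL aS (sfTG d) (fun i => (L : ℝ) ^ i.m) (fun i => CvX d L i.m i.kk hL × ι) (fun i => liftBlk (cvBlk d L i.m i.kk hL) ι) (fun i => (sfInstance d mm ι hL i).Bf),
        Kunit := covOnS d hL α β (sfTG d) (fun i => (L : ℝ) ^ i.m) (fun i => CvX d L i.m i.kk hL × ι) (fun i => liftBlk (cvBlk d L i.m i.kk hL) ι) (fun i => (sfInstance d mm ι hL i).Bf),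
        inΛ := fun _ _ => True, unitDist := fun i => (sfInstance d mm ι hL i).gc.dist } := rfl

/-- ★★ `N15At` at the literal from the operator layer by name (`d ≥ 1`, odd `L ≥ 3`, `a_S > 0`). [bookkeeping] -/
theorem n15At_sfObjects (hd : 1 ≤ d) (hLodd : Odd L) (hL2 : 2 ≤ L) (hL : Odd L ∧ 1 < L) {aS : ℝ} (haS : 0 < aS) (α β : Fin (d + 1)) {c35 : ℝ} (p : ℝ)
    (E : ∀ i : SfIdx d L, Fin 4 → (Fin (d + 1) → CvX' d L i.m i.kk i.r hL → Matrix mm mm ℂ) → ((CvX d L i.m i.kk hL × ι → ℝ) →ₗ[ℝ] (CvX' d L i.m i.kk i.r hL × ι → ℝ)))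
    (hop : NE2PlusOperator c35 (sfInstance d mm ι hL) (fun i => sfFamily d mm ι a e hL i (E i))) :
    N15At (ne2OfRecord₁₁ (sfObjects d mm ι a e hL E c35 p aS α β)) :=
  n15At_sf_of_ne2PlusOperator d mm ι a e hd hLodd hL2 hL haS α β p E hop

/-- ★★ the literal is LIVE (`c₃₅ ≥ 0`), whatever `E`. [bookkeeping] -/
theorem live_sfObjects (hL : Odd L ∧ 1 < L) {c35 : ℝ} (hc35 : 0 ≤ c35) (p aS : ℝ) (α β : Fin (d + 1))
    (E : ∀ i : SfIdx d L, Fin 4 → (Fin (d + 1) → CvX' d L i.m i.kk i.r hL → Matrix mm mm ℂ) → ((CvX d L i.m i.kk hL × ι → ℝ) →ₗ[ℝ] (CvX' d L i.m i.kk i.r hL × ι → ℝ))) :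
    Live (ne2OfRecord₁₁ (sfObjects d mm ι a e hL E c35 p aS α β)) :=
  live_sf d mm ι hL hc35 p _ _ _

variable {N : ℕ} [NeZero N] {key : (F : T4Family) → YMDAG.UVSplit.Datum F N → Prop}

/-- ★★ **n15-c's FAMILY AT ANY KEYED HOME** (part 30's interface): a rate home over ANY key admitting only the literals of a key-indexed NE2 reading whose value everywhere is `sfObjects … E …`
has `S_N15 RRec`, given the operator layer by name. [bookkeeping] -/
theorem s_N15_of_admits_sf (hd : 1 ≤ d) (hLodd : Odd L) (hL2 : 2 ≤ L) (hL : Odd L ∧ 1 < L) {aS : ℝ} (haS : 0 < aS) (α β : Fin (d + 1)) {c35 : ℝ} (p : ℝ)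
    (E : ∀ i : SfIdx d L, Fin 4 → (Fin (d + 1) → CvX' d L i.m i.kk i.r hL → Matrix mm mm ℂ) → ((CvX d L i.m i.kk hL × ι → ℝ) →ₗ[ℝ] (CvX' d L i.m i.kk i.r hL × ι → ℝ)))
    (hop : NE2PlusOperator c35 (sfInstance d mm ι hL) (fun i => sfFamily d mm ι a e hL i (E i)))
    (ne2At : ∀ {F : T4Family} {D : YMDAG.UVSplit.Datum F N}, key F D → (ℕ → ℝ) → List (ULoop F) → ℕ → NE2Objects₁₁) (RRec : YMDAG.UVSplit.RateRecordPred N)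
    (hadm : ∀ (F : T4Family) (D : YMDAG.UVSplit.Datum F N) (g₀ : ℕ → ℝ) (os : List (ULoop F)) (R : YMDAG.UVSplit.RateCarriers N), RRec F D g₀ os R →
      ∃ (h : key F D) (k : ℕ), R.ne2 = ne2OfRecord₁₁ (ne2At h g₀ os k))
    (h : ∀ (F : T4Family) (D : YMDAG.UVSplit.Datum F N) (h : key F D) (g₀ : ℕ → ℝ) (os : List (ULoop F)) (k : ℕ), ne2At h g₀ os k = sfObjects d mm ι a e hL E c35 p aS α β) :
    YMDAG.UVSplit.S_N15 RRec :=
  s_N15_of_admits ne2At RRec hadm fun F D hk g₀ os k => by rw [h F D hk g₀ os k]; exact n15At_sfObjects d mm ι a e hd hLodd hL2 hL haS α β p E hop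

end Summit.QuantumFields.YangMills.BalabanUVNodes.N15.GenuineRecord

end
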